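import Mathlib
import Literature.Computability.Complexity.PeresNoiseSensitivity
import Literature.Probability.Moments.HoeffdingNoise
import Literature.Computability.Complexity.RandomKSatLowDegreeHardness
import Summits.PneNP.PneNP.Theorems.OverlapGapAlgebraSearchHardWindowRobustClassRung

/-!
# Route OverlapGapAlgebra, crux `SearchHardWindow` (stmt-PneNP-2460): Efron–Stein tails of
# THRESHOLDS OF ADDITIVE STATISTICS on a finite product space (Peres's theorem, symmetrised)

An *additive-threshold* map on a product space `ι → Γ` is `g y = [θ < Σ_i w i (y i)]` for
arbitrary real weights `w : ι → Γ → ℝ` (on the `k`-SAT instance space, coordinates = literal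
slots, alphabet = literals: e.g. the majority-polarity vote for a variable, or any linear threshold
gate over the one-hot / bit encoding of the instance). This file proves that such maps have
uniformly small Efron–Stein (Hoeffding) tails:

**Theorem (`shwT_tail_le`).** For `G = (±1)^g` and every `d ≥ 1`,
`Σ_{|S| ≥ d} ‖G^{=S}‖² ≤ (4/√d) · ‖G‖²` (counting norms), uniformly in `ι`, `Γ`, the weights.

Proof. (1) *Symmetrisation* (`shwT_symm`): resampling the coordinates of a block `T` of `y` from an
independent copy `z` is, after conditioning on the unordered pair `{y i, z i}` at every coordinate,
a flip of the "which copy" bits on `T`; along these bits `g` is a linear threshold function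
`ε ↦ [θ < Σ_i (if ε i then w i (z i) else w i (y i))]`, so Peres's theorem in partition form
(`Literature.Computability.Complexity.peres_sum_card_blockFlip_le`) gives, for EVERY block labelling
`P : ι → Fin d`, `Σ_j Pr_{y,z}[g y ≠ g (y resampled on P⁻¹ j)] ≤ √d`.
(2) By `Literature.Probability.Moments.card_resample_ne_eq` the left side is
`½ Σ_j Σ_{S ∩ P⁻¹j ≠ ∅} ‖G^{=S}‖² / ‖G‖²`; averaging over all labellings `P`, a set `S` with
`|S| ≥ d` meets at least `d (1 − (1 − 1/d)^d) ≥ d/2` blocks on average (`shwT_bins`), whence the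
tail bound with constant `4` (O'Donnell 2014, Prop. 3.3 is the Boolean-cube prototype).
(3) Consequences packaged for the class rung (`shwT_truncation_dist_le`, `shwT_truncation_energy_le`,
`shwT_truncation_isCoordDegreeLE`): the low-degree truncation `Σ_{|S|<d} G^{=S}` is `4/√d`-close to
`G` in mean square, has energy `≤ ‖G‖²`, and coordinate degree `≤ d`.

No new definitions; axioms standard. References: Y. Peres, arXiv:math/0412377 [Peres2004];
R. O'Donnell, *Analysis of Boolean Functions* (2014) §5.5, Prop. 3.3, §8.3 [ODonnell2014].
-/

set_option linter.dupNamespace false -- `Summit.PneNP.PneNP.…`: summit = sub-problem (D-0017)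

noncomputable section

namespace Summit.PneNP.PneNP.Theorems

open Finset
open Literature.Computability.Complexity Literature.Probability.Moments
open scoped Classical

/-- **Symmetrisation + Peres.** For an additive-threshold map `g y = [θ < Σ_i w i (y i)]` on
`ι → Γ` and every block labelling `P : ι → κ`: summed over the blocks `j`, the number of pairs
`(y, z)` for which replacing the block-`j` coordinates of `y` by those of `z` changes `g` is at most
`√|κ| · #(ι → Γ)²`. (Condition on the coordinatewise unordered pairs: the resampling becomes a flip
of the "which copy" bits of block `j`, along which `g` is a linear threshold function; apply
`peres_sum_card_blockFlip_le`.) [cite: Peres2004, Thm. 1] -/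
theorem shwT_symm {ι Γ κ : Type*} [Fintype ι] [DecidableEq ι] [Fintype Γ] [Fintype κ]
    [DecidableEq κ] (g : (ι → Γ) → Bool) (w : ι → Γ → ℝ) (θ : ℝ)
    (hg : ∀ y, g y = decide (θ < ∑ i, w i (y i))) (P : ι → κ) :
    ∑ j : κ, ((univ.filter fun p : (ι → Γ) × (ι → Γ) =>
        g p.1 ≠ g ((univ.filter fun i => P i = j).piecewise p.2 p.1)).card : ℝ)
      ≤ Real.sqrt (Fintype.card κ) * (Fintype.card (ι → Γ) : ℝ) ^ 2 := by
  -- mixing the two copies along `ε : ι → Bool`, and the pair involution `Ψ_ε`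
  set mix : (ι → Bool) → (ι → Γ) × (ι → Γ) → (ι → Γ) :=
    fun ε p i => if ε i then p.2 i else p.1 i with hmix
  set Ψ : (ι → Bool) → (ι → Γ) × (ι → Γ) → (ι → Γ) × (ι → Γ) :=
    fun ε p => (mix ε p, mix (fun i => !ε i) p) with hΨ
  have hΨinv : ∀ ε, Function.Involutive (Ψ ε) := by
    intro ε p
    refine Prod.ext ?_ ?_ <;> funext i <;> simp only [hΨ, hmix] <;>
      rcases Bool.eq_false_or_eq_true (ε i) with h | h <;> simp [h]
  -- flipping block `j` of `ε` = resampling block `j` of the `Ψ_ε`-image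
  have hkey : ∀ ε j p, mix (fun i => if P i = j then !ε i else ε i) p =
      (univ.filter fun i => P i = j).piecewise (Ψ ε p).2 (Ψ ε p).1 := by
    intro ε j p; funext i
    simp only [hmix, hΨ, Finset.piecewise, mem_filter, mem_univ, true_and]
    by_cases hP : P i = j <;> rcases Bool.eq_false_or_eq_true (ε i) with h | h <;> simp [hP, h]
  -- Step 1: for fixed `ε`, the mixed count equals the resampling count
  have hstep1 : ∀ (ε : ι → Bool) (j : κ),
      ((univ.filter fun p : (ι → Γ) × (ι → Γ) =>
        g (mix ε p) ≠ g (mix (fun i => if P i = j then !ε i else ε i) p)).card : ℝ) =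
      ((univ.filter fun p : (ι → Γ) × (ι → Γ) =>
        g p.1 ≠ g ((univ.filter fun i => P i = j).piecewise p.2 p.1)).card : ℝ) := by
    intro ε j
    congr 1
    simp only [card_eq_sum_ones, sum_filter]
    exact Fintype.sum_equiv (hΨinv ε).toPerm _ _ fun p => by simp only [hkey]; rfl
  -- Step 2: along `ε`, `g ∘ mix · p` is a linear threshold function: Peres
  have hper : ∀ p : (ι → Γ) × (ι → Γ), ∑ ε : ι → Bool, ((univ.filter fun j : κ =>
      g (mix ε p) ≠ g (mix (fun i => if P i = j then !ε i else ε i) p)).card : ℝ)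
      ≤ Real.sqrt (Fintype.card κ) * (2 : ℝ) ^ Fintype.card ι := by
    intro p
    refine peres_sum_card_blockFlip_le (fun ε => g (mix ε p)) (fun i => w i (p.2 i))
      (fun i => w i (p.1 i)) θ (fun ε => ?_) P
    rw [hg]
    have hs : (∑ i, w i (mix ε p i)) = ∑ i, (if ε i then w i (p.2 i) else w i (p.1 i)) :=
      sum_congr rfl fun i _ => by
        simp only [hmix]; rcases Bool.eq_false_or_eq_true (ε i) with h | h <;> simp [h]
    exact decide_eq_decide.mpr (by rw [hs])
  -- Step 3: average over `ε` and exchange the counts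
  set A : ℝ := ∑ j : κ, ((univ.filter fun p : (ι → Γ) × (ι → Γ) =>
      g p.1 ≠ g ((univ.filter fun i => P i = j).piecewise p.2 p.1)).card : ℝ) with hA
  have hsum : (2 : ℝ) ^ Fintype.card ι * A = ∑ ε : ι → Bool, ∑ j : κ,
      ((univ.filter fun p : (ι → Γ) × (ι → Γ) =>
        g (mix ε p) ≠ g (mix (fun i => if P i = j then !ε i else ε i) p)).card : ℝ) := by
    simp only [hstep1]
    rw [sum_const, card_univ, Fintype.card_fun, Fintype.card_bool, nsmul_eq_mul]
    push_cast
    ring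
  have hex : ∑ ε : ι → Bool, ∑ j : κ,
      ((univ.filter fun p : (ι → Γ) × (ι → Γ) =>
        g (mix ε p) ≠ g (mix (fun i => if P i = j then !ε i else ε i) p)).card : ℝ) =
      ∑ p : (ι → Γ) × (ι → Γ), ∑ ε : ι → Bool, ((univ.filter fun j : κ =>
        g (mix ε p) ≠ g (mix (fun i => if P i = j then !ε i else ε i) p)).card : ℝ) := by
    calc ∑ ε : ι → Bool, ∑ j : κ, ((univ.filter fun p : (ι → Γ) × (ι → Γ) =>
          g (mix ε p) ≠ g (mix (fun i => if P i = j then !ε i else ε i) p)).card : ℝ)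
        = ∑ ε : ι → Bool, ∑ p : (ι → Γ) × (ι → Γ), ((univ.filter fun j : κ =>
          g (mix ε p) ≠ g (mix (fun i => if P i = j then !ε i else ε i) p)).card : ℝ) :=
          sum_congr rfl fun ε _ => shwF_sum_card_filter_comm (fun (j : κ) (p : (ι → Γ) × (ι → Γ)) =>
            g (mix ε p) ≠ g (mix (fun i => if P i = j then !ε i else ε i) p))
      _ = _ := sum_comm
  have hle : (2 : ℝ) ^ Fintype.card ι * A ≤
      (2 : ℝ) ^ Fintype.card ι * (Real.sqrt (Fintype.card κ) * (Fintype.card (ι → Γ) : ℝ) ^ 2) := by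
    rw [hsum, hex]
    calc ∑ p : (ι → Γ) × (ι → Γ), ∑ ε : ι → Bool, ((univ.filter fun j : κ =>
          g (mix ε p) ≠ g (mix (fun i => if P i = j then !ε i else ε i) p)).card : ℝ)
        ≤ ∑ _p : (ι → Γ) × (ι → Γ), Real.sqrt (Fintype.card κ) * (2 : ℝ) ^ Fintype.card ι :=
          sum_le_sum fun p _ => hper p
      _ = (2 : ℝ) ^ Fintype.card ι *
          (Real.sqrt (Fintype.card κ) * (Fintype.card (ι → Γ) : ℝ) ^ 2) := by
          rw [sum_const, card_univ, Fintype.card_prod, nsmul_eq_mul]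
          push_cast
          ring
  exact le_of_mul_le_mul_left hle (by positivity)

/-- The elementary estimate behind "a set of `≥ d` coordinates meets half of `d` random blocks":
`2 (d − 1)^s ≤ d^s` for `s ≥ d ≥ 1` (i.e. `(1 − 1/d)^s ≤ (1 − 1/d)^d ≤ e^{-1} ≤ 1/2`). [folklore] -/
theorem shwT_two_mul_pred_pow_le (d s : ℕ) (hd : 1 ≤ d) (hs : d ≤ s) :
    2 * ((d : ℝ) - 1) ^ s ≤ (d : ℝ) ^ s := by
  have hdpos : (0 : ℝ) < d := by exact_mod_cast hd
  have hx0 : (0 : ℝ) ≤ 1 - 1 / d := by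
    rw [sub_nonneg, div_le_one hdpos]; exact_mod_cast hd
  have hx1 : 1 - 1 / (d : ℝ) ≤ 1 := by
    have : (0 : ℝ) ≤ 1 / d := by positivity
    linarith
  -- `(1 - 1/d)^s ≤ (1 - 1/d)^d ≤ exp(-1/d)^d = exp(-1) ≤ 1/2`
  have h1 : (1 - 1 / (d : ℝ)) ^ s ≤ (1 - 1 / (d : ℝ)) ^ d := pow_le_pow_of_le_one hx0 hx1 hs
  have h2 : (1 - 1 / (d : ℝ)) ^ d ≤ Real.exp (-1) := by
    have hle : 1 - 1 / (d : ℝ) ≤ Real.exp (-1 / d) := by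
      have := Real.add_one_le_exp (-1 / (d : ℝ))
      linarith [show (-1 / (d : ℝ)) = -(1 / d) by ring]
    calc (1 - 1 / (d : ℝ)) ^ d ≤ Real.exp (-1 / d) ^ d := pow_le_pow_left₀ hx0 hle d
      _ = Real.exp (-1) := by
          rw [← Real.exp_nat_mul]; congr 1; field_simp
  have h3 : Real.exp (-1) ≤ 1 / 2 := by
    have he : (2 : ℝ) ≤ Real.exp 1 := by
      have := Real.add_one_le_exp (1 : ℝ); linarith
    rw [Real.exp_neg, ← one_div]
    exact one_div_le_one_div_of_le (by norm_num) he
  have hpow : ((d : ℝ) - 1) ^ s = (d : ℝ) ^ s * (1 - 1 / d) ^ s := by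
    rw [← mul_pow]; congr 1; field_simp
  rw [hpow]
  have hds : (0 : ℝ) ≤ (d : ℝ) ^ s := by positivity
  nlinarith [h1.trans (h2.trans h3), mul_nonneg hds (pow_nonneg hx0 s)]

/-- **Random blocks meet a large set often.** For `1 ≤ d ≤ |S|`, summed over all block labellings
`P : ι → Fin d`, the number of blocks `P⁻¹(j)` meeting `S` is at least `(d/2) · d^{|ι|}`
(exactly `d (1 − (1 − 1/d)^{|S|}) d^{|ι|}`; balls in bins). [folklore] -/
theorem shwT_bins {ι : Type*} [Fintype ι] [DecidableEq ι] (d : ℕ) (hd : 1 ≤ d) (S : Finset ι)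
    (hS : d ≤ S.card) :
    (d : ℝ) / 2 * Fintype.card (ι → Fin d) ≤
      ∑ P : ι → Fin d, ((univ.filter fun j : Fin d =>
        ¬ Disjoint S (univ.filter fun i => P i = j)).card : ℝ) := by
  rw [shwF_sum_card_filter_comm (fun (P : ι → Fin d) (j : Fin d) =>
    ¬ Disjoint S (univ.filter fun i => P i = j))]
  -- for each block index `j`, at most half of the labellings avoid `S`
  have hj : ∀ j : Fin d, (Fintype.card (ι → Fin d) : ℝ) / 2 ≤
      ((univ.filter fun P : ι → Fin d =>
        ¬ Disjoint S (univ.filter fun i => P i = j)).card : ℝ) := by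
    intro j
    -- the avoiding labellings form a box `Π_i (if i ∈ S then univ.erase j else univ)`
    have hbox : (univ.filter fun P : ι → Fin d => Disjoint S (univ.filter fun i => P i = j)) =
        Fintype.piFinset fun i => if i ∈ S then univ.erase j else univ := by
      ext P
      simp only [mem_filter, mem_univ, true_and, Fintype.mem_piFinset, Finset.disjoint_left]
      constructor
      · intro h i
        by_cases hi : i ∈ S
        · rw [if_pos hi, mem_erase]
          exact ⟨fun hP => h hi (by simpa using hP), mem_univ _⟩
        · rw [if_neg hi]; exact mem_univ _
      · intro h i hi hP
        have := h i
        rw [if_pos hi, mem_erase] at this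
        exact this.1 (by simpa using hP)
    have hcardN : (Fintype.piFinset fun i => if i ∈ S then (univ : Finset (Fin d)).erase j
        else univ).card = (d - 1) ^ S.card * d ^ (Fintype.card ι - S.card) := by
      rw [Fintype.card_piFinset]
      have hc : ∀ i, (if i ∈ S then (univ : Finset (Fin d)).erase j else univ).card =
          if i ∈ S then d - 1 else d := by
        intro i
        split_ifs
        · rw [card_erase_of_mem (mem_univ j), card_univ, Fintype.card_fin]
        · rw [card_univ, Fintype.card_fin]
      simp_rw [hc]
      rw [prod_ite, prod_const, prod_const]
      have hf1 : (univ.filter fun i => i ∈ S) = S := by ext i; simp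
      have hf2 : (univ.filter fun i => ¬ i ∈ S).card = Fintype.card ι - S.card := by
        rw [filter_not, hf1, card_univ_sdiff]
      rw [hf2, hf1]
    have hsplit := card_filter_add_card_filter_not
      (s := (univ : Finset (ι → Fin d)))
      (fun P : ι → Fin d => Disjoint S (univ.filter fun i => P i = j))
    rw [hbox, hcardN, card_univ] at hsplit
    -- `2 (d-1)^{|S|} d^{|ι|-|S|} ≤ d^{|ι|}`
    have hSle : S.card ≤ Fintype.card ι := S.card_le_univ
    have hpow : (Fintype.card (ι → Fin d) : ℝ) = (d : ℝ) ^ S.card * (d : ℝ) ^ (Fintype.card ι - S.card) := by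
      rw [Fintype.card_fun, Fintype.card_fin, ← pow_add, Nat.add_sub_cancel' hSle]
      push_cast
      ring
    have h2 := shwT_two_mul_pred_pow_le d S.card hd hS
    have hdc : (0 : ℝ) ≤ (d : ℝ) ^ (Fintype.card ι - S.card) := by positivity
    have hcast : (((d - 1) ^ S.card * d ^ (Fintype.card ι - S.card) : ℕ) : ℝ) =
        ((d : ℝ) - 1) ^ S.card * (d : ℝ) ^ (Fintype.card ι - S.card) := by
      push_cast [Nat.cast_sub hd]
      ring
    have hsplitR : (((d - 1) ^ S.card * d ^ (Fintype.card ι - S.card) : ℕ) : ℝ) +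
        ((univ.filter fun P : ι → Fin d =>
          ¬ Disjoint S (univ.filter fun i => P i = j)).card : ℝ) = Fintype.card (ι → Fin d) := by
      exact_mod_cast hsplit
    rw [hcast] at hsplitR
    rw [hpow] at hsplitR ⊢
    nlinarith [mul_le_mul_of_nonneg_right h2 hdc, hsplitR]
  calc (d : ℝ) / 2 * Fintype.card (ι → Fin d)
      = ∑ _j : Fin d, (Fintype.card (ι → Fin d) : ℝ) / 2 := by
        rw [sum_const, card_univ, Fintype.card_fin, nsmul_eq_mul]; ring
    _ ≤ _ := sum_le_sum fun j _ => hj j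

/-- **Efron–Stein tails of additive-threshold maps (Peres, symmetrised).** For
`g y = [θ < Σ_i w i (y i)]` on `ι → Γ`, `G = (±1)^g` and `d ≥ 1`:
`Σ_{|S| ≥ d} Σ_y (G^{=S} y)² ≤ (4/√d) · #(ι → Γ)`, uniformly in `ι`, `Γ` and the weights. (Average
`shwT_symm` over all block labellings `P : ι → Fin d`; by `card_resample_ne_eq` the resampling
count at a block `T` is `½ Σ_{S ∩ T ≠ ∅} ‖G^{=S}‖²`, and a set of `≥ d` coordinates meets `≥ d/2`
of the `d` blocks on average, `shwT_bins`.) The Boolean-cube prototype is O'Donnell 2014,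
Prop. 3.3 (`NS_δ ≤ ε ⇒ 3ε`-concentration up to degree `1/δ`). [cite: Peres2004, Thm. 1] -/
theorem shwT_tail_le {ι Γ : Type*} [Fintype ι] [DecidableEq ι] [Fintype Γ] [Nonempty Γ]
    (g : (ι → Γ) → Bool) (w : ι → Γ → ℝ) (θ : ℝ)
    (hg : ∀ y, g y = decide (θ < ∑ i, w i (y i))) (d : ℕ) (hd : 1 ≤ d) :
    ∑ S ∈ (univ : Finset ι).powerset.filter (fun S => d ≤ S.card),
        ∑ y, hoeffdingComp S (fun y => if g y then (1 : ℝ) else -1) y ^ 2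
      ≤ 4 / Real.sqrt d * Fintype.card (ι → Γ) := by
  haveI : NeZero d := ⟨by omega⟩
  have hNf : (0 : ℝ) < Fintype.card (ι → Γ) := by exact_mod_cast Fintype.card_pos
  have hNP : (0 : ℝ) < Fintype.card (ι → Fin d) := by exact_mod_cast Fintype.card_pos
  have hdpos : (0 : ℝ) < d := by exact_mod_cast hd
  have hb0 : ∀ S : Finset ι,
      0 ≤ ∑ y, hoeffdingComp S (fun y => if g y then (1 : ℝ) else -1) y ^ 2 :=
    fun S => sum_nonneg fun y _ => sq_nonneg _
  -- (1) the moving part at one block is a resampling count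
  have h1 : ∀ (P : ι → Fin d) (j : Fin d),
      (Fintype.card (ι → Γ) : ℝ) *
        ∑ S ∈ (univ : Finset ι).powerset.filter
          (fun S => ¬ Disjoint S (univ.filter fun i => P i = j)),
          ∑ y, hoeffdingComp S (fun y => if g y then (1 : ℝ) else -1) y ^ 2 =
      2 * ((univ.filter fun p : (ι → Γ) × (ι → Γ) =>
        g p.1 ≠ g ((univ.filter fun i => P i = j).piecewise p.2 p.1)).card : ℝ) := by
    intro P j
    have h := card_resample_ne_eq (univ.filter fun i => P i = j) g
    linarith
  -- (2) summed over blocks and labellings: symmetrisation + Peres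
  have h2 : ∑ P : ι → Fin d, ∑ j : Fin d, (Fintype.card (ι → Γ) : ℝ) *
        ∑ S ∈ (univ : Finset ι).powerset.filter
          (fun S => ¬ Disjoint S (univ.filter fun i => P i = j)),
          ∑ y, hoeffdingComp S (fun y => if g y then (1 : ℝ) else -1) y ^ 2 ≤
      Fintype.card (ι → Fin d) * (2 * (Real.sqrt d * (Fintype.card (ι → Γ) : ℝ) ^ 2)) := by
    calc ∑ P : ι → Fin d, ∑ j : Fin d, (Fintype.card (ι → Γ) : ℝ) *
          ∑ S ∈ (univ : Finset ι).powerset.filter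
            (fun S => ¬ Disjoint S (univ.filter fun i => P i = j)),
            ∑ y, hoeffdingComp S (fun y => if g y then (1 : ℝ) else -1) y ^ 2
        = ∑ P : ι → Fin d, 2 * ∑ j : Fin d, ((univ.filter fun p : (ι → Γ) × (ι → Γ) =>
            g p.1 ≠ g ((univ.filter fun i => P i = j).piecewise p.2 p.1)).card : ℝ) := by
          refine sum_congr rfl fun P _ => ?_
          rw [mul_sum]
          exact sum_congr rfl fun j _ => h1 P j
      _ ≤ ∑ _P : ι → Fin d, 2 * (Real.sqrt d * (Fintype.card (ι → Γ) : ℝ) ^ 2) := by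
          refine sum_le_sum fun P _ => ?_
          have := shwT_symm g w θ hg P
          rw [Fintype.card_fin] at this
          linarith
      _ = Fintype.card (ι → Fin d) * (2 * (Real.sqrt d * (Fintype.card (ι → Γ) : ℝ) ^ 2)) := by
          rw [sum_const, card_univ, nsmul_eq_mul]
  -- (3) exchange the sums: each `S` is weighted by the number of (labelling, block) pairs it meets
  have h3 : ∑ P : ι → Fin d, ∑ j : Fin d, (Fintype.card (ι → Γ) : ℝ) *
        ∑ S ∈ (univ : Finset ι).powerset.filter
          (fun S => ¬ Disjoint S (univ.filter fun i => P i = j)),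
          ∑ y, hoeffdingComp S (fun y => if g y then (1 : ℝ) else -1) y ^ 2 =
      (Fintype.card (ι → Γ) : ℝ) * ∑ S ∈ (univ : Finset ι).powerset,
        (∑ y, hoeffdingComp S (fun y => if g y then (1 : ℝ) else -1) y ^ 2) *
        ∑ P : ι → Fin d, ((univ.filter fun j : Fin d =>
          ¬ Disjoint S (univ.filter fun i => P i = j)).card : ℝ) := by
    simp only [← mul_sum]
    congr 1
    simp only [sum_filter]
    refine (sum_congr rfl fun P _ => sum_comm).trans ?_
    rw [sum_comm]
    refine sum_congr rfl fun S _ => ?_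
    rw [mul_sum]
    refine sum_congr rfl fun P _ => ?_
    rw [card_eq_sum_ones, Nat.cast_sum, sum_filter, mul_sum]
    refine sum_congr rfl fun j _ => ?_
    split_ifs <;> simp
  -- (4) keep only the sets of size `≥ d`, each meeting `≥ d/2 · #labellings` pairs
  have h4 : (d : ℝ) / 2 * Fintype.card (ι → Fin d) *
      ∑ S ∈ (univ : Finset ι).powerset.filter (fun S => d ≤ S.card),
        ∑ y, hoeffdingComp S (fun y => if g y then (1 : ℝ) else -1) y ^ 2 ≤
      ∑ S ∈ (univ : Finset ι).powerset,
        (∑ y, hoeffdingComp S (fun y => if g y then (1 : ℝ) else -1) y ^ 2) *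
        ∑ P : ι → Fin d, ((univ.filter fun j : Fin d =>
          ¬ Disjoint S (univ.filter fun i => P i = j)).card : ℝ) := by
    rw [mul_sum]
    calc ∑ S ∈ (univ : Finset ι).powerset.filter (fun S => d ≤ S.card),
          (d : ℝ) / 2 * Fintype.card (ι → Fin d) *
            ∑ y, hoeffdingComp S (fun y => if g y then (1 : ℝ) else -1) y ^ 2
        ≤ ∑ S ∈ (univ : Finset ι).powerset.filter (fun S => d ≤ S.card),
          (∑ y, hoeffdingComp S (fun y => if g y then (1 : ℝ) else -1) y ^ 2) *
            ∑ P : ι → Fin d, ((univ.filter fun j : Fin d =>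
              ¬ Disjoint S (univ.filter fun i => P i = j)).card : ℝ) := by
          refine sum_le_sum fun S hS => ?_
          rw [mul_comm]
          exact mul_le_mul_of_nonneg_left (shwT_bins d hd S (mem_filter.1 hS).2) (hb0 S)
      _ ≤ _ := by
          refine sum_le_sum_of_subset_of_nonneg (filter_subset _ _) fun S _ _ => ?_
          exact mul_nonneg (hb0 S) (sum_nonneg fun P _ => Nat.cast_nonneg _)
  -- (5) combine and divide
  have hM : (0 : ℝ) < Fintype.card (ι → Γ) * ((d : ℝ) / 2 * Fintype.card (ι → Fin d)) := by
    positivity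
  have key : Fintype.card (ι → Γ) * ((d : ℝ) / 2 * Fintype.card (ι → Fin d)) *
      ∑ S ∈ (univ : Finset ι).powerset.filter (fun S => d ≤ S.card),
        ∑ y, hoeffdingComp S (fun y => if g y then (1 : ℝ) else -1) y ^ 2 ≤
      Fintype.card (ι → Fin d) * (2 * (Real.sqrt d * (Fintype.card (ι → Γ) : ℝ) ^ 2)) := by
    rw [mul_assoc]
    refine le_trans (mul_le_mul_of_nonneg_left h4 hNf.le) ?_
    rw [← h3]
    exact h2
  have heq : (Fintype.card (ι → Fin d) : ℝ) * (2 * (Real.sqrt d * (Fintype.card (ι → Γ) : ℝ) ^ 2)) =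
      Fintype.card (ι → Γ) * ((d : ℝ) / 2 * Fintype.card (ι → Fin d)) *
        (4 / Real.sqrt d * Fintype.card (ι → Γ)) := by
    rw [show (4 : ℝ) / Real.sqrt d = 4 * ((d : ℝ) / Real.sqrt d) / d by
      field_simp]
    rw [Real.div_sqrt]
    field_simp
    ring
  rw [heq] at key
  exact le_of_mul_le_mul_left key hM

/-- **Truncation of an additive-threshold map**, (i) distance: for `d ≥ 1` the low-degree
truncation `Σ_{|S| < d} G^{=S}` of `G = (±1)^g` satisfies
`Σ_y (G y − Σ_{|S|<d} G^{=S} y)² ≤ (4/√d) · #(ι → Γ)`. [cite: Peres2004, Thm. 1] -/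
theorem shwT_truncation_dist_le {ι Γ : Type*} [Fintype ι] [DecidableEq ι] [Fintype Γ] [Nonempty Γ]
    (g : (ι → Γ) → Bool) (w : ι → Γ → ℝ) (θ : ℝ)
    (hg : ∀ y, g y = decide (θ < ∑ i, w i (y i))) (d : ℕ) (hd : 1 ≤ d) :
    ∑ y : ι → Γ, ((if g y then (1 : ℝ) else -1) -
        ∑ S ∈ (univ : Finset ι).powerset.filter (fun S => S.card < d),
          hoeffdingComp S (fun y => if g y then (1 : ℝ) else -1) y) ^ 2
      ≤ 4 / Real.sqrt d * Fintype.card (ι → Γ) := by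
  rw [sum_sq_sub_truncation_eq]
  exact shwT_tail_le g w θ hg d hd

/-- **Truncation of an additive-threshold map**, (ii) energy: `Σ_y (Σ_{|S|<d} G^{=S} y)² ≤ #(ι → Γ)`
(Bessel; `G² = 1`). [folklore] -/
theorem shwT_truncation_energy_le {ι Γ : Type*} [Fintype ι] [DecidableEq ι] [Fintype Γ]
    [Nonempty Γ] (g : (ι → Γ) → Bool) (d : ℕ) :
    ∑ y : ι → Γ, (∑ S ∈ (univ : Finset ι).powerset.filter (fun S => S.card < d),
        hoeffdingComp S (fun y => if g y then (1 : ℝ) else -1) y) ^ 2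
      ≤ Fintype.card (ι → Γ) := by
  refine (sum_sq_sum_hoeffdingComp_le _ _).trans (le_of_eq ?_)
  have h : ∀ y : ι → Γ, (if g y then (1 : ℝ) else -1) ^ 2 = 1 := fun y => by
    split_ifs <;> norm_num
  simp only [h, sum_const, card_univ, nsmul_eq_mul, mul_one]

/-- **Truncation of an additive-threshold map**, (iii) degree: `Σ_{|S|<d} G^{=S}` has coordinate
degree `≤ d` (`Literature.Computability.Complexity.IsCoordDegreeLE`). [folklore] -/
theorem shwT_truncation_isCoordDegreeLE {ι Γ : Type*} [Fintype ι] [DecidableEq ι] [Fintype Γ]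
    (G : (ι → Γ) → ℝ) (d : ℕ) :
    IsCoordDegreeLE d (fun y : ι → Γ =>
      ∑ S ∈ (univ : Finset ι).powerset.filter (fun S => S.card < d), hoeffdingComp S G y) :=
  truncation_isSumOfJuntas d G

end Summit.PneNP.PneNP.Theorems

end
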